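import Literature.NumberTheory.EllipticCurves.MatarNekovar2019.ShaIndexBoundIrreducible
import Literature.NumberTheory.Automorphic.BCDTModularity
import HarnessLib

/-!
# Matar–Nekovář 2019, Proposition 5.26 (2) and (3): for a quadratic field `K` with `(D_K, N) = 1` and
# an odd prime `p`, irreducibility of `E[p]` over `ℚ` implies irreducibility over `K` ((2), ONE named
# fact), and irreducibility over `K` is ABSOLUTE unless `(p, K) = (3, ℚ(√−3))` ((3), ONE named fact)

A. Matar, J. Nekovář, *Kolyvagin's result on the vanishing of `Ш(E/K)[p^∞]` and its consequences for
anticyclotomic Iwasawa theory*, J. Théor. Nombres Bordeaux **31** (2019), no. 2, 455–501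
(doi:10.5802/jtnb.1091; held as `paper:doi-10-5802-jtnb-1091`, READ 2026-08-27 on the materialised
pages p0039 L45–L47 and p0040 L1–L25). PUBLISHED, refereed (the *Correction*, JTNB **33** (2021)
627–628, concerns Thm. 6.7 (2) and Thm. 6.10 only). Sibling of `ShaIndexBoundIrreducible.lean`
(Thm. 0.3 + §0.11, whose §0.11 sentence already USES Prop. 5.26 (2) internally) and of
`ReducibleEigenline.lean`; this file isolates the one Galois-theoretic clause that the anticyclotomic
inputs of the rank-one `p`-part of BSD consume as their hypothesis (irred_𝒦) — Jetchev–Skinner–Wan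
2017 Thm. 3.3.1 (`JetchevSkinnerWan2017.thm331_anticyclotomicControl`), Burungale–Castella–Skinner
2025 Prop. 4.2.2 / Thm. 4.2.1 (`BurungaleCastellaSkinner2025.prop422_…`, `thm421b_…`) — at a prime
`p` where `ρ̄_{E,p}` is irreducible but NOT surjective (the residual class X9 of the BSD rank-`≤ 1`
programme: images `5Ns`, `5S4`, `7Ns`). For a SURJECTIVE `ρ̄_{E,p}` the tree proves (irred_𝒦) as a
theorem (`Summit.BirchSwinnertonDyer.Rank1Residual.irrK_of_surj`); for an irreducible non-surjective
image the implication is genuinely arithmetic (it fails for the one quadratic field cut out by a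
Cartan normaliser when that field is unramified at every prime of `N` — which the coprimality
hypothesis excludes), and is this proposition.

## The printed statement (verbatim, p. 492)

> **5.26. Proposition.** Let `E` be an elliptic curve over `ℚ` of conductor `N` and `K` a quadratic
> field of discriminant `D_K` relatively prime to `N`. Let `ρ := ρ̄_{E,p} : G_ℚ ⟶ Aut_{𝔽_p}(E[p]) ≃
> GL₂(𝔽_p)`, for a prime number `p ≠ 2`.
> (1) The field `L := ℚ(E[p])` has the following property:
> `ρ(G_ℚ) ≠ ρ(G_K) ⟺ L ∩ K = K ⟺ D_K = p* := (−1)^{(p−1)/2} p`.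
> (2) If `ρ` is irreducible, so is `ρ|_{G_K}`.
> (3) If `ρ|_{G_K}` is irreducible, but not absolutely irreducible, then `p = 3`, `K = ℚ(√−3)`, `E`
> has good ordinary reduction at `3`, `ρ(G_K)` is a cyclic group of order `4` and `ρ(G_ℚ)` is a
> dihedral group of order `8`.

Printed proof of (2) (p. 493, L1–L17): "If `ρ` is irreducible but `ρ|_{G_K}` is not, then `ρ|_{G_K}`
is semisimple (since `G_K` is a normal subgroup of `G_ℚ`) and its image is contained in a split Cartan
subgroup `C_s` of `GL₂(𝔽_p)`. Moreover, `ρ(G_ℚ) ≠ ρ(G_K)`, hence `D_K = p*` and `p ∤ N`, which means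
that `E` has good reduction at `p`. If the reduction at `p` is supersingular, then `ρ(G_{ℚ_p}) =
N(C_ns)` … which is impossible. If the reduction at `p` is ordinary, then the restriction of `ρ` to the
inertia group `I_p ⊂ G_{ℚ_p}` is given by `(χ_{p,ℚ_p} ∗; 0 1)`, by [27, Prop. 11]. … As a result,
`χ_{p,K_𝔭}|_{I_𝔭} = 1`, which implies that `χ²_{p,ℚ_p}(I_p) = 1`, `p = 3` and `K = ℚ(√−3)`. In this
case … `ρ(G_ℚ) ≃ (ℤ/2ℤ)^a` for some `a ≤ 2`, which contradicts the irreducibility of `ρ`." ([27] =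
Serre, Invent. Math. 15 (1972).)

## What is vendored (never stronger than print)

Clause (2) only: for `E/ℚ` (a Weierstrass model `W`, conductor `N_E = W.conductorNorm ℤ`), a number
field `K` with `[K : ℚ] = 2` (real OR imaginary — the proposition says "a quadratic field") whose
discriminant is prime to `N_E` (`Nat.Coprime (W.conductorNorm ℤ) |d_K|`), and a prime `p ≠ 2`: if
`E[p] = W(ℚ̄)[p]` is an irreducible `𝔽_p[G_ℚ]`-module (`W.HasIrreducibleModPGaloisRep p`) then
`E[p] = W_K(K̄)[p]` is an irreducible `𝔽_p[G_K]`-module (`(W.baseChange K).HasIrreducibleModPGaloisRep p`,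
the tree's (irred_𝒦) binder of the JSW / BCS facts, verbatim). Clauses (1) and (3) are NOT
transcribed (no consumer; (3) concerns absolute irreducibility, for which the tree has no
elliptic-curve predicate). Named fact (D-0014): nothing asserted; users take
`(h : prop526_hasIrreducibleModPGaloisRep_baseChange)`. Size M (Serre's description of the inertia
image at an ordinary / supersingular prime, the subgroup structure of `GL₂(𝔽_p)`, and the
ramification of `ℚ(E[p])` — the last is Néron–Ogg–Shafarevich, not in Mathlib); no `_holds` is
offered here.

APPENDED 2026-08-27 (cell `bsd-print-x9`, seat ty1; lit DOSSIER §8 rows 8.7 (ii) and H7′): clause (3)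
in the CONTRAPOSITIVE reading its consumers need, with the tree's elliptic-curve expression of absolute
irreducibility over `K` — the binder of Hsieh 2014 Thm. B as typed
(`Hsieh2014.thmB_exists_isHsiehLFunction_coeff_norm_eq_one`: every framed mod-`p` representation
`ρ : Γ_K → GL₂(𝔽_p)` of `E/K`, `(W.baseChange K).IsTorsionGaloisRep p ρ`, is
`FramedRep.IsAbsolutelyIrreducible`). Printed proof of (3) (p. 493, L18–L30): "Firstly, `ρ(G_K)` is
contained in `C_ns` but not in `C_ns ∩ C_s = 𝔽_p^× · I`. Secondly, `ρ(G_ℚ)` contains `ρ(c̃) ∉ C_ns`,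
hence `ρ(G_ℚ) ≠ ρ(G_K)`; thus `D_K = p*` and `E` has good reduction at `p`. If the reduction at `p` is
supersingular … [impossible]. …" (then the ordinary case forces `p = 3`, `K = ℚ(√−3)`).
* `prop526_three_of_irreducible_of_not_isAbsolutelyIrreducible` — clause (3) AS PRINTED in its first two
  conclusions (`p = 3` and `K = ℚ(√−3)`, i.e. `d_K = −3` for the quadratic field `K`); the further printed
  conclusions (good ordinary reduction at `3`, `ρ(G_K)` cyclic of order `4`, `ρ(G_ℚ)` dihedral of order
  `8`) are DROPPED (weaker fact; `-- TODO(general form)`), since stating them needs a fixed model at `3`.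
  ONE new named fact.
* `isAbsolutelyIrreducible_baseChange_of_prop526_three` (PROVED, logic): away from `(p, d_K) = (3, −3)`,
  (irr_K) ⟹ absolute irreducibility over `K`.
* `isAbsolutelyIrreducible_baseChange_of_irreducible` (PROVED, (2) ∘ (3)): for `p ≠ 2`, `(N, d_K) = 1`,
  `(p, d_K) ≠ (3, −3)`: `E[p]` irreducible over `ℚ` ⟹ absolutely irreducible over `K` — the form in which
  the X9 Heegner frames (p ∈ {5, 7}, `p` split in `K`, so `d_K ≠ −3` is not even needed) discharge Hsieh's
  hypothesis and the absolute-irreducibility input of the level-`p^M` Čebotarev step (McCallum 1991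
  Cor. 3.2 / Jetchev 2008 Lemma 6.1 with Remark 6.2, whose tree proof
  `McCallum1991_cor_3_2_pow_of_chebotarev` consumes it in Schur form through `KolyvaginImage.exists_eq_zsmul`).

Consumers at a Heegner field: under the Heegner hypothesis for `N_E` every prime of `N_E` splits in
`K`, so `(N_E, d_K) = 1` (tree theorem `Literature.SatisfiesHeegnerHypothesis.coprime_discr`) and the
fact applies (the two-line bookkeeping lives with the consumer, Summits-side).

## References

* [MatarNekovar2019] A. Matar, J. Nekovář, J. Théor. Nombres Bordeaux 31 (2019) 455–501, Prop. 5.26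
  (p. 492) and its proof (p. 493).
* [Serre1972] J.-P. Serre, Invent. Math. 15 (1972) 259–331, Prop. 11, Prop. 12 (the inertia image at a
  good prime), §2 (subgroups of `GL₂(𝔽_p)`) — the inputs of the printed proof.
* Consumers' hypothesis (irred_𝒦): [JetchevSkinnerWan2017] Thm. 3.3.1 (hypothesis (irr));
  [BurungaleCastellaSkinner2025] §4.2 (irr_K) (p. 7), Prop. 4.2.2, Thm. 4.2.1.
* Consumers of absolute irreducibility over `K`: [Hsieh2014] Thm. B hypothesis (2) (Doc. Math. 19
  p. 712); [Jetchev2008] Remark 6.2 (arXiv) = Remark 2 (Compos. Math. 144 p. 821); [McCallumLMS1991] §3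
  (2), Prop. 3.1, Cor. 3.2.
-/

noncomputable section

open scoped Classical

open WeierstrassCurve

universe u

namespace Literature.NumberTheory.EllipticCurves.MatarNekovar2019

/-- **Matar–Nekovář, JTNB 31 (2019), Proposition 5.26 (2)** (p. 492, proof p. 493), verbatim: "Let `E`
be an elliptic curve over `ℚ` of conductor `N` and `K` a quadratic field of discriminant `D_K`
relatively prime to `N`. Let `ρ := ρ̄_{E,p} : G_ℚ ⟶ Aut_{𝔽_p}(E[p]) ≃ GL₂(𝔽_p)`, for a prime number
`p ≠ 2`. … (2) If `ρ` is irreducible, so is `ρ|_{G_K}`." TRANSCRIBED (module docstring): `W` a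
Weierstrass model over `ℚ` of the elliptic curve `E` (`W.IsElliptic`), of conductor
`N = W.conductorNorm ℤ`; `K` a number field with `[K : ℚ] = 2` ("a quadratic field", real or
imaginary) and `(N, d_K) = 1` (`Nat.Coprime (W.conductorNorm ℤ) (NumberField.discr K).natAbs`); `p` a
prime, `p ≠ 2`; hypothesis "`ρ` is irreducible" = `W.HasIrreducibleModPGaloisRep p` (`E(ℚ̄)[p]` is an
irreducible `𝔽_p[G_ℚ]`-module); conclusion "`ρ|_{G_K}` is irreducible" =
`(W.baseChange K).HasIrreducibleModPGaloisRep p` (`E_K(K̄)[p]` is an irreducible `𝔽_p[G_K]`-module —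
the (irred_𝒦) binder of `JetchevSkinnerWan2017.thm331_anticyclotomicControl` and of
`BurungaleCastellaSkinner2025.prop422_exists_isBDPLFunction_mu_eq_zero`, verbatim). Clauses (1), (3)
not transcribed. PUBLISHED THEOREM with printed proof (Serre's Prop. 11/12 + subgroups of `GL₂(𝔽_p)`
+ ramification of `ℚ(E[p])`). Named fact: nothing asserted; size M; no `_holds`.
[cite: MatarNekovar2019, Prop. 5.26 (2) (p. 492) and its proof (p. 493)]
[cite: Serre1972, Prop. 11 and Prop. 12 (the inputs of the printed proof)] -/
def prop526_hasIrreducibleModPGaloisRep_baseChange : Prop :=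
  ∀ (W : WeierstrassCurve ℚ) [W.IsElliptic] (K : Type) [Field K] [NumberField K],
    Module.finrank ℚ K = 2 → Nat.Coprime (W.conductorNorm ℤ) (NumberField.discr K).natAbs →
    ∀ (p : ℕ) [Fact p.Prime], p ≠ 2 → W.HasIrreducibleModPGaloisRep p →
      (W.baseChange K).HasIrreducibleModPGaloisRep p

/-! ## Clause (3): irreducibility over `K` is absolute unless `(p, K) = (3, ℚ(√−3))` -/

/-- **Matar–Nekovář, JTNB 31 (2019), Proposition 5.26 (3)** (p. 492, proof p. 493), verbatim: "Let `E`
be an elliptic curve over `ℚ` of conductor `N` and `K` a quadratic field of discriminant `D_K`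
relatively prime to `N`. Let `ρ := ρ̄_{E,p} : G_ℚ ⟶ Aut_{𝔽_p}(E[p]) ≃ GL₂(𝔽_p)`, for a prime number
`p ≠ 2`. … (3) If `ρ|_{G_K}` is irreducible, but not absolutely irreducible, then `p = 3`,
`K = ℚ(√−3)`, `E` has good ordinary reduction at `3`, `ρ(G_K)` is a cyclic group of order `4` and
`ρ(G_ℚ)` is a dihedral group of order `8`." TRANSCRIBED with the binders of clause (2)
(`prop526_hasIrreducibleModPGaloisRep_baseChange`: `W/ℚ` elliptic, `K` a number field with
`[K : ℚ] = 2`, `(N, d_K) = 1` for `N = W.conductorNorm ℤ`, `p ≠ 2` prime); hypothesis "`ρ|_{G_K}`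
irreducible" = `(W.baseChange K).HasIrreducibleModPGaloisRep p`; "not absolutely irreducible" = SOME
framed mod-`p` representation `ρ : Γ_K → GL₂(𝔽_p)` of `E/K` (`(W.baseChange K).IsTorsionGaloisRep p ρ`,
file `BCDTModularity`; framings exist and are `GL₂(𝔽_p)`-conjugate, `exists_isTorsionGaloisRep`) is
not `FramedRep.IsAbsolutelyIrreducible` (irreducible after every extension of scalars — the letter of
Hsieh 2014 Thm. B's binder as typed); conclusion: `p = 3` and `K = ℚ(√−3)`, the latter as
`NumberField.discr K = −3` (a quadratic field is determined by its discriminant). The three further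
printed conclusions (good ORDINARY reduction at `3`; `ρ(G_K)` cyclic of order `4`; `ρ(G_ℚ)` dihedral of
order `8`) are not transcribed — WEAKER than print, never stronger.
-- TODO(general form): add `E` good ordinary at `3`, `#ρ(G_K) = 4` cyclic, `ρ(G_ℚ) ≅ D₈` (needs a model at `3`).
PUBLISHED THEOREM with printed proof (Serre 1972 Prop. 11/12, subgroups of `GL₂(𝔽_p)`). Named fact:
nothing asserted; size M; no `_holds`.
[cite: MatarNekovar2019, Prop. 5.26 (3) (p. 492) and its proof (p. 493, L18–L30 of the held page p0040)]
[cite: Serre1972, Prop. 11 and Prop. 12 (the inputs of the printed proof)] -/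
def prop526_three_of_irreducible_of_not_isAbsolutelyIrreducible : Prop :=
  ∀ (W : WeierstrassCurve ℚ) [W.IsElliptic] (K : Type) [Field K] [NumberField K],
    Module.finrank ℚ K = 2 → Nat.Coprime (W.conductorNorm ℤ) (NumberField.discr K).natAbs →
    ∀ (p : ℕ) [Fact p.Prime], p ≠ 2 → (W.baseChange K).HasIrreducibleModPGaloisRep p →
      ∀ ρ : Literature.NumberTheory.GaloisRepresentations.ModPGaloisRep K (ZMod p) 2,
        (W.baseChange K).IsTorsionGaloisRep p ρ →
        ¬ Literature.NumberTheory.GaloisRepresentations.FramedRep.IsAbsolutelyIrreducible ρ →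
        p = 3 ∧ NumberField.discr K = -3

/-- **Prop. 5.26 (3), contrapositive**: for `(N, d_K) = 1`, `p ≠ 2` and `(p, d_K) ≠ (3, −3)`, an
`E[p]` irreducible over `K` is ABSOLUTELY irreducible over `K` (every framing). Logic from the fact.
[cite: MatarNekovar2019, Prop. 5.26 (3) (p. 492)] -/
theorem isAbsolutelyIrreducible_baseChange_of_prop526_three
    (h3 : prop526_three_of_irreducible_of_not_isAbsolutelyIrreducible)
    (W : WeierstrassCurve ℚ) [W.IsElliptic] (K : Type) [Field K] [NumberField K]
    (hK : Module.finrank ℚ K = 2) (hcop : Nat.Coprime (W.conductorNorm ℤ) (NumberField.discr K).natAbs)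
    (p : ℕ) [Fact p.Prime] (hp : p ≠ 2) (h33 : ¬ (p = 3 ∧ NumberField.discr K = -3))
    (hirrK : (W.baseChange K).HasIrreducibleModPGaloisRep p)
    (ρ : Literature.NumberTheory.GaloisRepresentations.ModPGaloisRep K (ZMod p) 2)
    (hρ : (W.baseChange K).IsTorsionGaloisRep p ρ) :
    Literature.NumberTheory.GaloisRepresentations.FramedRep.IsAbsolutelyIrreducible ρ := by
  by_contra habs
  exact h33 (h3 W K hK hcop p hp hirrK ρ hρ habs)

/-- **Prop. 5.26 (2) ∘ (3)**: for a quadratic field `K` with `(N, d_K) = 1`, a prime `p ≠ 2` with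
`(p, d_K) ≠ (3, −3)`, and `E[p]` IRREDUCIBLE OVER `ℚ`: `E[p]` is absolutely irreducible over `K`
(every framing `ρ : Γ_K → GL₂(𝔽_p)` of `E/K`). On a Heegner field at a split prime `p` (`p ∤ d_K`)
the side condition is automatic; this is the discharge of Hsieh 2014 Thm. B's hypothesis (2) and of
the absolute-irreducibility input of McCallum 1991 §3 (2) / Jetchev 2008 Rem. 6.2 on such frames.
[cite: MatarNekovar2019, Prop. 5.26 (2) and (3) (p. 492)] [cite: Hsieh2014, Thm. B hypothesis (2)]
[cite: Jetchev2008, Remark 6.2 (arXiv:math/0703431 p0015 L27–L31) = Remark 2 (p. 821)] -/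
theorem isAbsolutelyIrreducible_baseChange_of_irreducible
    (h2 : prop526_hasIrreducibleModPGaloisRep_baseChange)
    (h3 : prop526_three_of_irreducible_of_not_isAbsolutelyIrreducible)
    (W : WeierstrassCurve ℚ) [W.IsElliptic] (K : Type) [Field K] [NumberField K]
    (hK : Module.finrank ℚ K = 2) (hcop : Nat.Coprime (W.conductorNorm ℤ) (NumberField.discr K).natAbs)
    (p : ℕ) [Fact p.Prime] (hp : p ≠ 2) (h33 : ¬ (p = 3 ∧ NumberField.discr K = -3))
    (hirr : W.HasIrreducibleModPGaloisRep p)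
    (ρ : Literature.NumberTheory.GaloisRepresentations.ModPGaloisRep K (ZMod p) 2)
    (hρ : (W.baseChange K).IsTorsionGaloisRep p ρ) :
    Literature.NumberTheory.GaloisRepresentations.FramedRep.IsAbsolutelyIrreducible ρ :=
  isAbsolutelyIrreducible_baseChange_of_prop526_three h3 W K hK hcop p hp h33
    (h2 W K hK hcop p hp hirr) ρ hρ

end Literature.NumberTheory.EllipticCurves.MatarNekovar2019

end
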